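import Mathlib.LinearAlgebra.LinearIndependent.Lemmas
import Mathlib.LinearAlgebra.Basis.VectorSpace
import Mathlib.Algebra.Algebra.Basic
import Mathlib.RingTheory.SimpleRing.Basic
import HarnessLib

/-!
# Linear independence of vectors with coordinates in a subfield is insensitive to the scalars

Let `K/k` be a field extension and `v₁, …, vₙ ∈ k^κ` vectors with coordinates in the small field
(`κ` an ARBITRARY index set — e.g. the coefficient sequences of power series). Then the `vᵢ` are
linearly independent over `K` (inside `K^κ`) iff they are linearly independent over `k`;
equivalently, a non-trivial linear relation `∑ cᵢ vᵢ = 0` with coefficients `cᵢ ∈ K` can be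
replaced by one with coefficients in `k` (`exists_ne_zero_linearRelation_of_algebraMap`). Mathlib
has the statement for FINITE `κ` (`linearIndependent_algebraMap_comp_iff`, by flat base change
`K ⊗ₖ k^κ = K^κ`); for infinite `κ` the base change map `K ⊗ₖ k^κ → K^κ` is no longer onto, but
the elementary argument still works: normalise a `K`-relation so that one coefficient is `1` and
apply a `k`-linear retraction `π : K → k` of the inclusion coordinatewise (Bourbaki, *Algebra II*,
Ch. II §8, no. 8 — rationality of the space of linear relations; §7 no. 10 Prop. 23 for the
finite case). This is the linear-algebra step in "an algebraic relation over `ℂ(x)` between power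
series with coefficients in `k ⊆ ℂ` may be taken with coefficients in `k(x)`", used for the
`q`-expansions of modular forms (Calegari–Dimitrov–Tang, arXiv:2109.09040, §1: algebraicity of a
modular form over `ℚ̄(λ)` from its algebraicity over `ℂ(λ)`).

* `linearIndependent_algebraMap_comp_iff_of_field` — `K`-independence of `(algebraMap k K ∘ vᵢ)ᵢ`
  `↔` `k`-independence of `(vᵢ)ᵢ`, any index types;
* `exists_ne_zero_linearRelation_of_algebraMap` — descent of a non-trivial linear relation.

## References

* N. Bourbaki, *Algebra II*, Chapter II, §8 (rational structures on vector spaces), §7 no. 10.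
* [CalegariDimitrovTang2025] F. Calegari, V. Dimitrov, Y. Tang, J. Amer. Math. Soc. 38 (2025),
  arXiv:2109.09040, §1 p. 3 (the context of use).
-/

namespace Literature.LinearAlgebra.BaseChange

open Function

/-- **Linear independence over an extension field of vectors with coordinates in the base
field.** For a field extension `K/k` and a family `v : ι → κ → k` (arbitrary index types), the
family `(algebraMap k K ∘ v i)ᵢ` in `K^κ` is `K`-linearly independent iff `v` is `k`-linearly
independent. (`→`: restrict scalars. `←`: if `∑ cᵢ vᵢ = 0` with `cᵢ ∈ K` and `c_{i₀} ≠ 0`,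
rescale to `c_{i₀} = 1` and apply a `k`-linear retraction `π : K → k` of `k ↪ K` in each
coordinate: `∑ π(cᵢ) vᵢ = 0` with `π(c_{i₀}) = 1`.) [folklore] -/
theorem linearIndependent_algebraMap_comp_iff_of_field {k K : Type*} [Field k] [Field K]
    [Algebra k K] {ι κ : Type*} {v : ι → κ → k} :
    LinearIndependent K (fun i ↦ algebraMap k K ∘ v i) ↔ LinearIndependent k v := by
  constructor
  · intro h
    have h' := h.restrict_scalars' k
    exact h'.of_comp ((Algebra.linearMap k K).compLeft κ)
  · intro hv
    rw [linearIndependent_iff'] at hv ⊢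
    intro s g hg i hi
    by_contra hne
    -- a `k`-linear retraction of `k ↪ K`
    obtain ⟨π, hπ⟩ := LinearMap.exists_leftInverse_of_injective (Algebra.linearMap k K)
      (LinearMap.ker_eq_bot.mpr (algebraMap k K).injective)
    have hπ1 : π 1 = 1 := by
      have h1 := LinearMap.congr_fun hπ 1
      rwa [LinearMap.comp_apply, Algebra.linearMap_apply, map_one, LinearMap.id_apply] at h1
    -- normalise the relation so that the `i`-th coefficient is `1`
    set g' : ι → K := fun j ↦ (g i)⁻¹ * g j with hg'
    have hsum : ∑ j ∈ s, g' j • (algebraMap k K ∘ v j) = 0 := by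
      simp only [hg', mul_smul, ← Finset.smul_sum, hg, smul_zero]
    have hgi : g' i = 1 := inv_mul_cancel₀ hne
    -- apply `π` coordinatewise
    have key : ∑ j ∈ s, π (g' j) • v j = 0 := by
      ext m
      have hm := congr_fun hsum m
      simp only [Finset.sum_apply, Pi.smul_apply, comp_apply, smul_eq_mul, Pi.zero_apply]
        at hm ⊢
      have h2 : ∑ j ∈ s, v j m • g' j = 0 := by
        simpa only [Algebra.smul_def, mul_comm] using hm
      have h3 := congrArg π h2
      rw [map_sum, map_zero] at h3
      simpa only [map_smul, smul_eq_mul, mul_comm] using h3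
    have h0 := hv s (fun j ↦ π (g' j)) key i hi
    rw [hgi, hπ1] at h0
    exact one_ne_zero h0

/-- **A non-trivial linear relation with coefficients in an extension field descends to the base
field.** If `v₁, …, vₙ ∈ k^κ` satisfy `∑ᵢ cᵢ vᵢ = 0` coordinatewise with `c ∈ Kⁿ ∖ {0}`, then
`∑ᵢ c'ᵢ vᵢ = 0` for some `c' ∈ kⁿ ∖ {0}`. [folklore] -/
theorem exists_ne_zero_linearRelation_of_algebraMap {k K : Type*} [Field k] [Field K]
    [Algebra k K] {ι κ : Type*} [Fintype ι] {v : ι → κ → k} {c : ι → K} (hc : c ≠ 0)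
    (h : ∀ m, ∑ i, c i * algebraMap k K (v i m) = 0) :
    ∃ c' : ι → k, c' ≠ 0 ∧ ∀ m, ∑ i, c' i * v i m = 0 := by
  classical
  have hdep : ¬ LinearIndependent K (fun i ↦ algebraMap k K ∘ v i) := by
    rw [Fintype.not_linearIndependent_iff]
    refine ⟨c, ?_, Function.ne_iff.mp hc⟩
    ext m
    simpa only [Finset.sum_apply, Pi.smul_apply, comp_apply, smul_eq_mul, Pi.zero_apply]
      using h m
  rw [linearIndependent_algebraMap_comp_iff_of_field, Fintype.not_linearIndependent_iff] at hdep
  obtain ⟨c', hc', i, hi⟩ := hdep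
  refine ⟨c', Function.ne_iff.mpr ⟨i, hi⟩, fun m ↦ ?_⟩
  have := congr_fun hc' m
  simpa only [Finset.sum_apply, Pi.smul_apply, smul_eq_mul, Pi.zero_apply] using this

end Literature.LinearAlgebra.BaseChange
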